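import Mathlib
import HarnessLib
import Literature.MathematicalPhysics.QuantumFieldTheory.QCDOS
import Literature.MathematicalPhysics.QuantumFieldTheory.QCDPhaseQuenchedReweighting

/-!
# Sketch — first lemmas of the three crux-idea cards for `GluonicCompletion` (stmt-QuantumFields-9152)

Planner scratch file (crux-ideate round 1, ideator 1). Each `def … : Prop` is the FIRST checkable
statement of one line; none is proved here (they only have to elaborate).

* `TwistedPauliBandLimit` — card `fibre-flatness-conditional-package`: the Pauli band limit of the
  Wilson sea (support item `PauliWegnerSea.PauliBandLimit`, degree ≤ 4 along a diagonal one-parameter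
  subgroup of one link) is UNCHANGED by a twisted mass `−iη Γ₅` (equivalently: by moving the Hermitian
  Wilson–Dirac resolvent to the complex energy `iη`), because the twist is link-independent. This is the
  entry point of "degree-only constants are uniform in the environment, the twist and the mass".
* `JacobiComplementaryMinor` — card `one-minor-per-flavour`: Jacobi's theorem, the `(p,p)` minor of
  `M⁻¹` times `det M` is the complementary `(q,q)` minor of `M` (pole-free), the algebraic backbone of
  the integrability table (one complementary minor per flavour).
* `SignCostsTwoAtSchemeVolume` — card `finite-sign-budget-at-the-scheme-volume`: clause (iv) of the
  hypothesis package (`‖∫det‖ ≥ ½ ∫‖det‖` at the scheme's own side) converts every phase-quenched UPPER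
  bound on a Berezin ratio into an honest bound on `qcdTorusExpect` with the constant `2`.
-/

namespace Summit.QuantumFields.QCD.Cruxes.GluonicCompletion.Sketch

open scoped BigOperators Matrix Kronecker
open MeasureTheory Filter
open Literature.MathematicalPhysics.QuantumFieldTheory Literature.MathematicalPhysics.QuantumLattice
  Literature.Probability.LatticeModels

/-- First lemma of card `fibre-flatness-conditional-package`: twisted-mass / complex-energy version of
the Pauli band limit. For every torus, background `U`, bare mass `m₀`, twist `η`, edge `e` and the
one-parameter family `T(θ) = diag(e^{iθ}, e^{−iθ}, 1)`, the function
`θ ↦ det (D_W(U[e ↦ U_e T(θ)]; m₀, 1) − iη Γ₅)` is a trigonometric polynomial of degree ≤ 4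
(the twist term is diagonal and θ-independent, so the rank-2 × multilinearity count of
`PauliBandLimit` applies verbatim; `(Γ₅ D_W − iη)⁻¹ = (D_W − iηΓ₅)⁻¹ Γ₅` is the resolvent of the
Hermitian Wilson–Dirac operator at energy `iη`). -/
def TwistedPauliBandLimit : Prop :=
  ∀ (L : ℕ) [NeZero L] (U : GaugeConfig 4 L (Matrix.specialUnitaryGroup (Fin 3) ℂ)) (m₀ η : ℝ)
    (e : Edge 4 L) (T : ℝ → Matrix.specialUnitaryGroup (Fin 3) ℂ),
    (∀ θ : ℝ, ((T θ : Matrix.specialUnitaryGroup (Fin 3) ℂ) : Matrix (Fin 3) (Fin 3) ℂ) =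
      Matrix.diagonal ![Complex.exp (θ * Complex.I), Complex.exp (-(θ * Complex.I)), 1]) →
    ∃ c : Fin 9 → ℂ, ∀ θ : ℝ,
      (wilsonDirac (fundamentalRep (Fin 3)) (Function.update U e (U e * T θ)) m₀ 1 -
          (((η : ℂ) * Complex.I) • spinorLift (L := L) (N := 3) gammaFive)).det =
        ∑ k : Fin 9, c k * Complex.exp ((((k : ℕ) : ℝ) - 4 : ℝ) * θ * Complex.I)

/-- First lemma of card `one-minor-per-flavour`: **Jacobi's complementary-minor identity** — for an
invertible block matrix `M` on `p ⊕ q`, `det((M⁻¹)₁₁) · det M = det(M₂₂)`. The right-hand side is a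
polynomial in the entries (no inverse power of `det M`): the Berezin ratio of ANY product of quark
fields of one flavour, multiplied by that flavour's determinant, is pole-free on the crossing set
`{det D_f = 0}`; only SPLITS of that product into separately integrated factors create poles. -/
def JacobiComplementaryMinor : Prop :=
  ∀ (p q : Type) [Fintype p] [Fintype q] [DecidableEq p] [DecidableEq q]
    (M : Matrix (p ⊕ q) (p ⊕ q) ℂ), IsUnit M.det →
      (M⁻¹.toBlocks₁₁).det * M.det = (M.toBlocks₂₂).det

/-- First lemma of card `finite-sign-budget-at-the-scheme-volume`: **the sign costs a factor two where
clause (iv) holds**. On a torus of side `S` at couplings `(β, m_q)`, if `‖∫ det D dμ_W‖ ≥ ½ ∫ ‖det D‖ dμ_W`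
(clause (iv) of `MobilityGap`/`OneScaleTrajectory`, available at the scheme's OWN side `2L_k+1` only),
then for every Grassmann-valued gauge functional `X` the honest functional is bounded by twice the
phase-quenched expectation of the modulus of its Berezin ratio:
`‖⟨X⟩_{β,S,m}‖ ≤ 2 ⟨ ‖⟨X⟩_F(U)‖ ⟩₊`. (Proof idea: `qcdTorusExpect_eq_phaseQuenched`,
`‖⟨W·Y⟩₊‖ ≤ ⟨‖Y‖⟩₊`, `‖⟨W⟩₊‖ ≥ ½`; the null set `{det D = 0}` is the only measure-theoretic point.) -/
def SignCostsTwoAtSchemeVolume : Prop :=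
  ∀ (Nf S : ℕ) [NeZero S] (β : ℝ) (mq : Fin Nf → ℝ) (X : GaugeConfig 4 S SU3 → FermiAlg Nf S),
    (1 / 2 : ℝ) ≤
        ‖∫ U : GaugeConfig 4 S SU3, (diracMatrix U mq).det
            ∂(wilsonMeasure (d := 4) (L := S) (fundamentalRep (Fin 3)) β)‖ /
          ∫ U : GaugeConfig 4 S SU3, ‖(diracMatrix U mq).det‖
            ∂(wilsonMeasure (d := 4) (L := S) (fundamentalRep (Fin 3)) β) →
      ‖qcdTorusExpect β S mq X‖ ≤
        2 * qcdPhaseQuenchedExpect β S mq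
          (fun U => ‖fermiIntegral (X U * fermiBoltzmann U mq) / fermiIntegral (fermiBoltzmann U mq)‖)

end Summit.QuantumFields.QCD.Cruxes.GluonicCompletion.Sketch
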